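import Mathlib.CategoryTheory.Category.Factorisation
import Mathlib.CategoryTheory.Category.Preorder
import Mathlib.CategoryTheory.Equivalence
import Mathlib.Order.Basic
import Literature.AlgebraicGeometry.Frobenioids.Categories
import Literature.AlgebraicGeometry.Frobenioids.CategoriesFactorization
import HarnessLib

/-!
# Frobenioids II, §0: dissection, ordered monomorphisms, grafting

Mochizuki, *The geometry of Frobenioids II: poly-Frobenioids*, Kyushu J. Math. **62** (2008)
401–460, §0 "Notations and Conventions", paragraph **Categories** (author's text pp. 5–6)
[cite: MochizukiFrdII2008, §0 pp.5-6]. This is the category-theoretic vocabulary that §1 (connected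
quasi-temperoids, Example 1.3 (i); localizations of number fields, Proposition 1.5 (vii), (ix)) and
§3 (Theorem 3.6 (viii), (ix)) of [FrdII] add to the "Categories" paragraph of [FrdI] §0
(`Categories.lean`, `CategoriesFactorization.lean`).

**Contents (one declaration per printed notion).**
* strongly / weakly dissecting families of arrows `{φᵢ : Aᵢ → A}`; strongly / weakly dissectible and
  strongly / weakly indissectible objects; the four corresponding "types" of categories; the two
  printed implications (strongly dissectible ⇒ weakly dissectible, strongly indissectible ⇒ weakly
  indissectible) proved;
* arrow-wise essentially surjective, relatively initial and totally non-initial functors;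
* the category `C_φ` of factorizations of an arrow `φ` (= Mathlib's `Factorisation φ`), the category
  `C^↣_φ` of factorizations of a monomorphism through monomorphisms, totally / continuously /
  quasi-totally / quasi-continuously ordered monomorphisms, and the six corresponding "types";
* (the grafted category `C ⊣_E D` and the coproduct category `∐ᵢ Cᵢ` of p. 6 are in the sibling
  file `Grafting.lean`).

**Dictionary / design.** "Nonempty [i.e., non-initial]" objects are `IsNonemptyObj` of
`Categories.lean`. `Order(E)` for a totally ordered set `E` is Mathlib's preorder category of a
`LinearOrder`. A "pair of arrows" is a family indexed by `Fin 2`. In `C^↣_φ` we take the full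
subcategory of `Factorisation φ` on factorizations through monomorphisms; its arrows are then
automatically monomorphisms (`MonoFactorisations.mono_h`), so this is literally the printed category.
Deliberately NOT here: the observation (p. 5) that a Frobenioid over a base of weakly indissectible
(resp. strongly/weakly dissectible) type is itself of that type (it needs [FrdI] Def. 1.3 and belongs
with the Frobenioid files).
-/

namespace Literature.AlgebraicGeometry.Frobenioids

open CategoryTheory CategoryTheory.Limits

universe w v v₁ v₂ v₃ u u₁ u₂ u₃

/-! ### Dissecting families; (in)dissectible objects (p. 5) -/

section Dissection

variable {C : Type u} [Category.{v} C]

/-- A family of arrows `{φᵢ : Aᵢ → A}` with non-initial domains *strongly dissects* `A` if for every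
pair of distinct indices `i ≠ j` there is NO pair of arrows `ψᵢ : B → Aᵢ`, `ψⱼ : B → Aⱼ` with `B`
a nonempty object (FrdII §0 p. 5). [cite: MochizukiFrdII2008, §0 p.5] -/
def StronglyDissects {ι : Type w} {A : C} {X : ι → C} (_φ : ∀ i, X i ⟶ A) : Prop :=
  (∀ i, IsNonemptyObj (X i)) ∧
    ∀ ⦃i j : ι⦄, i ≠ j → ∀ ⦃B : C⦄, IsNonemptyObj B → ¬ (Nonempty (B ⟶ X i) ∧ Nonempty (B ⟶ X j))

/-- A family of arrows `{φᵢ : Aᵢ → A}` with non-initial domains *weakly dissects* `A` if for every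
pair of distinct indices `i ≠ j` there is no pair of arrows `ψᵢ : B → Aᵢ`, `ψⱼ : B → Aⱼ` from a
nonempty object `B` with `φᵢ ∘ ψᵢ = φⱼ ∘ ψⱼ` (FrdII §0 p. 5). [cite: MochizukiFrdII2008, §0 p.5] -/
def WeaklyDissects {ι : Type w} {A : C} {X : ι → C} (φ : ∀ i, X i ⟶ A) : Prop :=
  (∀ i, IsNonemptyObj (X i)) ∧
    ∀ ⦃i j : ι⦄, i ≠ j → ∀ ⦃B : C⦄, IsNonemptyObj B →
      ∀ (ψi : B ⟶ X i) (ψj : B ⟶ X j), ψi ≫ φ i ≠ ψj ≫ φ j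

/-- A strongly dissecting family is weakly dissecting. [cite: MochizukiFrdII2008, §0 p.5] -/
theorem StronglyDissects.weaklyDissects {ι : Type w} {A : C} {X : ι → C} {φ : ∀ i, X i ⟶ A}
    (h : StronglyDissects φ) : WeaklyDissects φ :=
  ⟨h.1, fun _ _ hij _ hB ψi ψj _ => h.2 hij hB ⟨⟨ψi⟩, ⟨ψj⟩⟩⟩

/-- `A` is *strongly dissectible* if it admits a strongly dissecting pair of arrows (FrdII §0 p. 5).
[cite: MochizukiFrdII2008, §0 p.5] -/
def IsStronglyDissectible (A : C) : Prop :=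
  ∃ (X : Fin 2 → C) (φ : ∀ i, X i ⟶ A), StronglyDissects φ

/-- `A` is *weakly dissectible* if it admits a weakly dissecting pair of arrows (FrdII §0 p. 5).
[cite: MochizukiFrdII2008, §0 p.5] -/
def IsWeaklyDissectible (A : C) : Prop :=
  ∃ (X : Fin 2 → C) (φ : ∀ i, X i ⟶ A), WeaklyDissects φ

/-- `A` is *strongly indissectible* if it is not weakly dissectible (FrdII §0 p. 5).
[cite: MochizukiFrdII2008, §0 p.5] -/
def IsStronglyIndissectible (A : C) : Prop := ¬ IsWeaklyDissectible A

/-- `A` is *weakly indissectible* if it is not strongly dissectible (FrdII §0 p. 5).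
[cite: MochizukiFrdII2008, §0 p.5] -/
def IsWeaklyIndissectible (A : C) : Prop := ¬ IsStronglyDissectible A

/-- "Thus, if `A` is strongly dissectible, then it is weakly dissectible" (FrdII §0 p. 5).
[cite: MochizukiFrdII2008, §0 p.5] -/
theorem IsStronglyDissectible.isWeaklyDissectible {A : C} (h : IsStronglyDissectible A) :
    IsWeaklyDissectible A := by
  obtain ⟨X, φ, hφ⟩ := h
  exact ⟨X, φ, hφ.weaklyDissects⟩

/-- "… if `A` is strongly indissectible, then it is weakly indissectible" (FrdII §0 p. 5).
[cite: MochizukiFrdII2008, §0 p.5] -/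
theorem IsStronglyIndissectible.isWeaklyIndissectible {A : C} (h : IsStronglyIndissectible A) :
    IsWeaklyIndissectible A :=
  fun h' => h h'.isWeaklyDissectible

variable (C)

/-- `C` is *of strongly dissectible type* if every object is strongly dissectible (FrdII §0 p. 5).
[cite: MochizukiFrdII2008, §0 p.5] -/
@[mk_iff] structure IsOfStronglyDissectibleType : Prop where
  /-- every object is strongly dissectible -/
  isStronglyDissectible : ∀ A : C, IsStronglyDissectible A

/-- `C` is *of weakly dissectible type* if every object is weakly dissectible (FrdII §0 p. 5).
[cite: MochizukiFrdII2008, §0 p.5] -/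
@[mk_iff] structure IsOfWeaklyDissectibleType : Prop where
  /-- every object is weakly dissectible -/
  isWeaklyDissectible : ∀ A : C, IsWeaklyDissectible A

/-- `C` is *of strongly indissectible type* if every object is strongly indissectible
(FrdII §0 p. 5). [cite: MochizukiFrdII2008, §0 p.5] -/
@[mk_iff] structure IsOfStronglyIndissectibleType : Prop where
  /-- every object is strongly indissectible -/
  isStronglyIndissectible : ∀ A : C, IsStronglyIndissectible A

/-- `C` is *of weakly indissectible type* if every object is weakly indissectible (FrdII §0 p. 5).
[cite: MochizukiFrdII2008, §0 p.5] -/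
@[mk_iff] structure IsOfWeaklyIndissectibleType : Prop where
  /-- every object is weakly indissectible -/
  isWeaklyIndissectible : ∀ A : C, IsWeaklyIndissectible A

variable {C}

/-- Categories of strongly dissectible type are of weakly dissectible type.
[cite: MochizukiFrdII2008, §0 p.5] -/
theorem IsOfStronglyDissectibleType.isOfWeaklyDissectibleType (h : IsOfStronglyDissectibleType C) :
    IsOfWeaklyDissectibleType C :=
  ⟨fun A => (h.isStronglyDissectible A).isWeaklyDissectible⟩

/-- Categories of strongly indissectible type are of weakly indissectible type.
[cite: MochizukiFrdII2008, §0 p.5] -/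
theorem IsOfStronglyIndissectibleType.isOfWeaklyIndissectibleType
    (h : IsOfStronglyIndissectibleType C) : IsOfWeaklyIndissectibleType C :=
  ⟨fun A => (h.isStronglyIndissectible A).isWeaklyIndissectible⟩

end Dissection

/-! ### Three kinds of functors (p. 5) -/

section Functors

variable {C : Type u₁} [Category.{v₁} C] {D : Type u₂} [Category.{v₂} D]

/-- `Φ : C → D` is *arrow-wise essentially surjective* if it is surjective on abstract equivalence
classes of arrows: every arrow of `D` is abstractly equivalent [FrdI §0] to the image of an arrow
of `C` (FrdII §0 p. 5). [cite: MochizukiFrdII2008, §0 p.5] -/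
def IsArrowwiseEssSurj (Φ : C ⥤ D) : Prop :=
  ∀ ⦃X Y : D⦄ (g : X ⟶ Y), ∃ (A B : C) (f : A ⟶ B), IsAbstractlyEquivalent (Φ.map f) g

/-- `Φ : C → D` is *relatively initial* if every object `B` of `D` receives an arrow `Φ(A) → B`
from the image of some object `A` of `C` (FrdII §0 p. 5). [cite: MochizukiFrdII2008, §0 p.5] -/
def IsRelativelyInitial (Φ : C ⥤ D) : Prop :=
  ∀ B : D, ∃ A : C, Nonempty (Φ.obj A ⟶ B)

/-- `Φ : C → D` is *totally non-initial* if `Φ(A)` is non-initial for every object `A` of `C`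
(FrdII §0 p. 5). [cite: MochizukiFrdII2008, §0 p.5] -/
def IsTotallyNonInitial (Φ : C ⥤ D) : Prop :=
  ∀ A : C, IsNonemptyObj (Φ.obj A)

/-- An essentially surjective functor is relatively initial (via the isomorphism `Φ(A) ≅ B`).
[cite: MochizukiFrdII2008, §0 p.5] -/
theorem isRelativelyInitial_of_essSurj (Φ : C ⥤ D) [Φ.EssSurj] : IsRelativelyInitial Φ :=
  fun B => ⟨Φ.objPreimage B, ⟨(Φ.objObjPreimageIso B).hom⟩⟩

end Functors

/-! ### The category of factorizations; ordered monomorphisms (pp. 5–6) -/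

section Ordered

variable {C : Type u} [Category.{v} C]

/-- `C_φ`: the category whose objects are factorizations `A —α→ X —β→ B` of `φ` and whose arrows
are the `ψ : X₁ → X₂` with `ψ ∘ α₁ = α₂`, `β₂ ∘ ψ = β₁` (FrdII §0 p. 5) — literally Mathlib's
`Factorisation φ`. [cite: MochizukiFrdII2008, §0 p.5] -/
abbrev factorizationCat {A B : C} (φ : A ⟶ B) := Factorisation φ

/-- The objects of `C^↣_φ` for a monomorphism `φ`: factorizations of `φ` inside the subcategory
`C^↣ ⊆ C` of monomorphisms, i.e. `A ↣ X ↣ B` with both arrows monomorphisms (FrdII §0 pp. 5–6).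
[cite: MochizukiFrdII2008, §0 pp.5-6] -/
def monoFactorisations {A B : C} (φ : A ⟶ B) : ObjectProperty (Factorisation φ) :=
  fun F => Mono F.ι ∧ Mono F.π

/-- `C^↣_φ`: the category of factorizations of the monomorphism `φ` through monomorphisms, as the
full subcategory of `C_φ` (FrdII §0 pp. 5–6; its arrows are automatically monomorphisms, see
`MonoFactorisations.mono_h`). [cite: MochizukiFrdII2008, §0 pp.5-6] -/
abbrev MonoFactorisations {A B : C} (φ : A ⟶ B) := (monoFactorisations φ).FullSubcategory

/-- In `C^↣_φ` every arrow `ψ : X₁ → X₂` is a monomorphism of `C` (because `β₂ ∘ ψ = β₁` is), so the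
full subcategory of `C_φ` on mono-factorizations IS the category of factorizations of `φ` in `C^↣`.
[cite: MochizukiFrdII2008, §0 pp.5-6] -/
theorem MonoFactorisations.mono_h {A B : C} {φ : A ⟶ B} {F G : MonoFactorisations φ}
    (ψ : F ⟶ G) : Mono ψ.hom.h := by
  haveI : Mono F.obj.π := F.property.2
  exact mono_of_mono_fac ψ.hom.h_π

/-- A monomorphism `φ` is *totally ordered* if `C^↣_φ` is equivalent to `Order(E)` for some totally
ordered set `E` (FrdII §0 p. 6). [cite: MochizukiFrdII2008, §0 p.6] -/
def IsTotallyOrderedHom {A B : C} (φ : A ⟶ B) : Prop :=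
  Mono φ ∧ ∃ (E : Type (max u v)) (_ : LinearOrder E), Nonempty (MonoFactorisations φ ≌ E)

/-- A monomorphism `φ` is *continuously ordered* if `C^↣_φ ≃ Order(E)` with `E` totally ordered and
dense: for `a < b` there is `c` with `a < c < b` (FrdII §0 p. 6). [cite: MochizukiFrdII2008, §0 p.6] -/
def IsContinuouslyOrderedHom {A B : C} (φ : A ⟶ B) : Prop :=
  Mono φ ∧ ∃ (E : Type (max u v)) (_ : LinearOrder E),
    DenselyOrdered E ∧ Nonempty (MonoFactorisations φ ≌ E)

/-- A continuously ordered monomorphism is totally ordered. [cite: MochizukiFrdII2008, §0 p.6] -/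
theorem IsContinuouslyOrderedHom.isTotallyOrderedHom {A B : C} {φ : A ⟶ B}
    (h : IsContinuouslyOrderedHom φ) : IsTotallyOrderedHom φ := by
  obtain ⟨hm, E, inst, _, he⟩ := h
  exact ⟨hm, E, inst, he⟩

/-- "Factors as a finite composite of arrows in the class `P`": the smallest class containing `P`
and closed under post-composition with arrows of `P` (used on FrdII §0 p. 6 for quasi-totally /
quasi-continuously ordered arrows). [cite: MochizukiFrdII2008, §0 p.6] -/
inductive IsFiniteCompositeOf (P : MorphismProperty C) : ∀ {A B : C}, (A ⟶ B) → Prop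
  /-- a single arrow of `P` -/
  | single {A B : C} (f : A ⟶ B) : P f → IsFiniteCompositeOf P f
  /-- post-composing a finite composite with an arrow of `P` -/
  | comp {A B B' : C} (f : A ⟶ B) (g : B ⟶ B') :
      IsFiniteCompositeOf P f → P g → IsFiniteCompositeOf P (f ≫ g)

/-- Finite composites of finite composites are finite composites. [cite: MochizukiFrdII2008, §0 p.6] -/
theorem IsFiniteCompositeOf.trans {P : MorphismProperty C} {A B B' : C} {f : A ⟶ B} {g : B ⟶ B'}
    (hf : IsFiniteCompositeOf P f) (hg : IsFiniteCompositeOf P g) : IsFiniteCompositeOf P (f ≫ g) := by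
  induction hg with
  | single g hg => exact .comp f g hf hg
  | comp g g' _ hg' ih => rw [← Category.assoc]; exact .comp _ g' ih hg'

/-- A monomorphism is *quasi-totally ordered* if it is an isomorphism or factors as a finite
composite of totally ordered monomorphisms (FrdII §0 p. 6). [cite: MochizukiFrdII2008, §0 p.6] -/
def IsQuasiTotallyOrderedHom {A B : C} (φ : A ⟶ B) : Prop :=
  Mono φ ∧ (IsIso φ ∨ IsFiniteCompositeOf (fun _ _ f => IsTotallyOrderedHom f) φ)

/-- A monomorphism is *quasi-continuously ordered* if it is an isomorphism or factors as a finite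
composite of continuously ordered monomorphisms (FrdII §0 p. 6).
[cite: MochizukiFrdII2008, §0 p.6] -/
def IsQuasiContinuouslyOrderedHom {A B : C} (φ : A ⟶ B) : Prop :=
  Mono φ ∧ (IsIso φ ∨ IsFiniteCompositeOf (fun _ _ f => IsContinuouslyOrderedHom f) φ)

/-- A totally ordered monomorphism is quasi-totally ordered. [cite: MochizukiFrdII2008, §0 p.6] -/
theorem IsTotallyOrderedHom.isQuasiTotallyOrderedHom {A B : C} {φ : A ⟶ B}
    (h : IsTotallyOrderedHom φ) : IsQuasiTotallyOrderedHom φ :=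
  ⟨h.1, Or.inr (.single φ h)⟩

/-- Finite composites are monotone in the class `P`. [cite: MochizukiFrdII2008, §0 p.6] -/
theorem IsFiniteCompositeOf.of_le {P Q : MorphismProperty C}
    (hPQ : ∀ {A B : C} (f : A ⟶ B), P f → Q f) {A B : C} {f : A ⟶ B}
    (h : IsFiniteCompositeOf P f) : IsFiniteCompositeOf Q f := by
  induction h with
  | single f hf => exact .single f (hPQ f hf)
  | comp f g _ hg ih => exact .comp f g ih (hPQ g hg)

/-- Quasi-continuously ordered monomorphisms are quasi-totally ordered.
[cite: MochizukiFrdII2008, §0 p.6] -/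
theorem IsQuasiContinuouslyOrderedHom.isQuasiTotallyOrderedHom {A B : C} {φ : A ⟶ B}
    (h : IsQuasiContinuouslyOrderedHom φ) : IsQuasiTotallyOrderedHom φ :=
  ⟨h.1, h.2.imp id fun hc => hc.of_le fun _ hf => hf.isTotallyOrderedHom⟩

variable (C)

/-- `C` is *of strictly partially ordered type* if every totally ordered morphism of `C` is an
isomorphism (FrdII §0 p. 6). [cite: MochizukiFrdII2008, §0 p.6] -/
@[mk_iff] structure IsOfStrictlyPartiallyOrderedType : Prop where
  /-- totally ordered arrows are isomorphisms -/
  isIso : ∀ {A B : C} (φ : A ⟶ B), IsTotallyOrderedHom φ → IsIso φ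

/-- `C` is *of discontinuously ordered type* if every continuously ordered morphism of `C` is an
isomorphism (FrdII §0 p. 6). [cite: MochizukiFrdII2008, §0 p.6] -/
@[mk_iff] structure IsOfDiscontinuouslyOrderedType : Prop where
  /-- continuously ordered arrows are isomorphisms -/
  isIso : ∀ {A B : C} (φ : A ⟶ B), IsContinuouslyOrderedHom φ → IsIso φ

/-- `C` is *of totally ordered type* if every morphism of `C` is totally ordered (FrdII §0 p. 6).
[cite: MochizukiFrdII2008, §0 p.6] -/
@[mk_iff] structure IsOfTotallyOrderedType : Prop where
  /-- every arrow is a totally ordered monomorphism -/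
  isTotallyOrderedHom : ∀ {A B : C} (φ : A ⟶ B), IsTotallyOrderedHom φ

/-- `C` is *of quasi-totally ordered type* if every morphism of `C` is quasi-totally ordered
(FrdII §0 p. 6). [cite: MochizukiFrdII2008, §0 p.6] -/
@[mk_iff] structure IsOfQuasiTotallyOrderedType : Prop where
  /-- every arrow is a quasi-totally ordered monomorphism -/
  isQuasiTotallyOrderedHom : ∀ {A B : C} (φ : A ⟶ B), IsQuasiTotallyOrderedHom φ

/-- `C` is *of continuously ordered type* if every morphism of `C` is continuously ordered
(FrdII §0 p. 6). [cite: MochizukiFrdII2008, §0 p.6] -/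
@[mk_iff] structure IsOfContinuouslyOrderedType : Prop where
  /-- every arrow is a continuously ordered monomorphism -/
  isContinuouslyOrderedHom : ∀ {A B : C} (φ : A ⟶ B), IsContinuouslyOrderedHom φ

/-- `C` is *of quasi-continuously ordered type* if every morphism of `C` is quasi-continuously
ordered (FrdII §0 p. 6). [cite: MochizukiFrdII2008, §0 p.6] -/
@[mk_iff] structure IsOfQuasiContinuouslyOrderedType : Prop where
  /-- every arrow is a quasi-continuously ordered monomorphism -/
  isQuasiContinuouslyOrderedHom : ∀ {A B : C} (φ : A ⟶ B), IsQuasiContinuouslyOrderedHom φ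

variable {C}

/-- A category of strictly partially ordered type is of discontinuously ordered type.
[cite: MochizukiFrdII2008, §0 p.6] -/
theorem IsOfStrictlyPartiallyOrderedType.isOfDiscontinuouslyOrderedType
    (h : IsOfStrictlyPartiallyOrderedType C) : IsOfDiscontinuouslyOrderedType C :=
  ⟨fun φ hφ => h.isIso φ hφ.isTotallyOrderedHom⟩

/-- A category of continuously ordered type is of totally ordered type.
[cite: MochizukiFrdII2008, §0 p.6] -/
theorem IsOfContinuouslyOrderedType.isOfTotallyOrderedType (h : IsOfContinuouslyOrderedType C) :
    IsOfTotallyOrderedType C :=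
  ⟨fun φ => (h.isContinuouslyOrderedHom φ).isTotallyOrderedHom⟩

/-- A category of totally ordered type is of quasi-totally ordered type.
[cite: MochizukiFrdII2008, §0 p.6] -/
theorem IsOfTotallyOrderedType.isOfQuasiTotallyOrderedType (h : IsOfTotallyOrderedType C) :
    IsOfQuasiTotallyOrderedType C :=
  ⟨fun φ => (h.isTotallyOrderedHom φ).isQuasiTotallyOrderedHom⟩

end Ordered

end Literature.AlgebraicGeometry.Frobenioids
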